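import Summits.BirchSwinnertonDyer.Rank1Residual.X11b.ClassClosureSymbolTableCertificate
import Literature.NumberTheory.EllipticCurves.PAdicLFunctionRiemannSumCongruenceCertificateProofs
import HarnessLib

/-!
# Class X11b = N8 (lane CLASS-CLOSURE, seat `cc-typer-3`): the unit-coefficient certificate from a
# symbol table certified MODULO `p` — `k < p^{n₀}`, `‖RS k n₀‖_p = 1`, `C·p⁻¹ < 1` — i.e. the
# (μ, λ)-census fold's own reading, for EVERY index (cell `b2b-bsdres`)

HONEST FRAMING (verbatim, cell `b2b-bsdres`, run/shared/lean/b2b/bsd-rank1-residual/): the goal of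
the cell is to DELETE the COMBINATION-SHAPED residual classes for ALL analytic-rank `≤ 1` curves
over `ℚ` — "full BSD formula for every rank `≤ 1` curve in class `C`" assembled STRICTLY from
published theorems — so that the rank-`≤ 1` remainder becomes exactly the CONSTRUCTION-SHAPED
classes, which are TYPED (missing-input Props), NOT attempted; this is not "finishing BSD".
Lane CLASS-CLOSURE: prove what is provable now; shrink each hard class to its core with data; no
claim beyond stated classes. THEOREMS ONLY (no definition, no named fact, no `sorry`); nothing
booked; no label / mark changes; certificate rows are EVIDENCE / instrumentation.

## Why this file

`ClassClosureSymbolTableCertificate` (p290353) turns a symbol table `x = u·ϖ₀·[·]⁺_{f₀}` certified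
in its own currency into iw-1's `Iwasawa.RiemannSumUnitCertAt W p n`, whose per-index condition is
the TRUNCATION inequality `(C/‖k!‖_p)·p^{−n₀} < ‖RS k n₀‖` (continuity of `x ↦ (ℓ(x) choose k)`).
For a large index `k = λ` that inequality wants a deep table (`n₀ > v_p(k!) + log_p C`): the
instrument note of cc-eng-6 (HOME/class-closure/eng-6/n8-mu/INSTANTIATION-NOTE.md §3) lists N8
rows (`λ = 51, 52` at `p = 7`; `λ = 10, 12` at `p = 5`) whose tables are too shallow for it but
which the fold reads MODULO `p`: `[T^j](ϖ·L_p) ≡ b_j (mod p)` for `j < p^{n₀}`. The Literature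
theorems `IsMultPAdicLFunctionOf.norm_coeff_eq_of_nonsplit_of_mul_inv_lt` /
`IsSplitMultPAdicLFunctionOf.norm_coeff_eq_of_split_of_mul_inv_lt`
(`PAdicLFunctionRiemannSumCongruenceCertificateProofs`: Mazur–Tate–Teitelbaum's compatibility of the
Riemann polynomials modulo `ω_{n₀} ≡ T^{p^{n₀}} (mod p)`, via Lucas) make that reading a kernel
certificate: `k < p^{n₀}` and `C·p⁻¹ < ‖RS k n₀‖` ⟹ `‖[T^k]L‖ = ‖RS k n₀‖. This file composes it
with the symbol-table scaling (`exists_riemannSum_eq_const_mul`; homogeneous, so `ϖ₀` of any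
valuation) and p277881's one-newform bookkeeping: `norm_coeff_C_mul_eq_one_of_symbolTable_modP_
{nonsplit,split}` (`‖[T^k](ϖ₀·L)‖ = 1` for THE function of `f₀`), `unitCoeffAt_of_symbolTable_modP`
(index `n` non-split / `n + 1` split), `muAnZeroAt_of_symbolTable_modP`, and the class-level
minimal-pair roads `bsdp_of_symbolTable_modP_one` (¬(ram), p276240) /
`bsdp_of_ram_of_symbolTable_modP_one` ((ram), p282302). For a `p`-INTEGRAL table (`C ≤ 1`) and a unit
Riemann sum `C·p⁻¹ < 1` is automatic, so the per-pair content is exactly: `hx` (the identification,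
cc-eng-6 §1), integrality of the table, `p^{n₀} > k`, ONE unit Riemann sum. Nothing about any curve
is asserted; nothing booked; which rows instantiate the hypotheses is the census seats' EVIDENCE.

References: [MazurTateTeitelbaum1986Invent] §I.10, §I.12–I.14; [SteinWuthrich2013] §3, §4.2; [Wuthrich2014]
Thm. 3; [Skinner2016PacificMC] Thm. A; [Disegni2020] Thm. 1; HOME/class-closure/O2/TYPER-3.md §14.
-/

set_option autoImplicit false

noncomputable section

open scoped Classical MatrixGroups ModularForm

open CongruenceSubgroup WeierstrassCurve Literature.NumberTheory.EllipticCurves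
  Literature.NumberTheory.EllipticCurves.ModularForms
  Literature.NumberTheory.EllipticCurves.Rank1Residual
  Literature.NumberTheory.EllipticCurves.Rank1Residual.Typed
  Literature.NumberTheory.EllipticCurves.Skinner2016
  Literature.NumberTheory.EllipticCurves.SteinWuthrich2013
  Literature.NumberTheory.EllipticCurves.Wuthrich2014
  Literature.NumberTheory.EllipticCurves.Disegni2020

namespace Summit.BirchSwinnertonDyer.Rank1Residual.X11b.ClassClosure

open X11a

section Scaling

variable {p : ℕ} [Fact p.Prime]

/-- The Riemann sums of a scaled distribution `ψ = c·φ` are `c·` those of `φ`. [folklore] -/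
theorem exists_riemannSum_eq_const_mul {φ ψ : (m : ℕ) → ZMod (p ^ m) → ℚ_[p]} {c : ℚ_[p]}
    (hψ : ∀ (m : ℕ) (a : ZMod (p ^ m)), ψ m a = c * φ m a) {RS : ℕ → ℕ → ℚ_[p]}
    (hRS : ∀ k m : ℕ, RS k m =
      ∑ᶠ ξ : rootsOfUnity (torsionOrder p) ℤ_[p], ∑ s : ZMod (p ^ m),
        ψ (m + cyclotomicExponent p)
            (PadicInt.toZModPow (m + cyclotomicExponent p) ((ξ : ℤ_[p]ˣ) : ℤ_[p]) *
              (cyclotomicGenerator p : ZMod (p ^ (m + cyclotomicExponent p))) ^ s.val) *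
          ((s.val.choose k : ℕ) : ℚ_[p])) :
    ∃ RS' : ℕ → ℕ → ℚ_[p],
      (∀ k m : ℕ, RS' k m =
        ∑ᶠ ξ : rootsOfUnity (torsionOrder p) ℤ_[p], ∑ s : ZMod (p ^ m),
          φ (m + cyclotomicExponent p)
              (PadicInt.toZModPow (m + cyclotomicExponent p) ((ξ : ℤ_[p]ˣ) : ℤ_[p]) *
                (cyclotomicGenerator p : ZMod (p ^ (m + cyclotomicExponent p))) ^ s.val) *
            ((s.val.choose k : ℕ) : ℚ_[p])) ∧
      ∀ k m : ℕ, RS k m = c * RS' k m := by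
  refine ⟨fun k m ↦ ∑ᶠ ξ : rootsOfUnity (torsionOrder p) ℤ_[p], ∑ s : ZMod (p ^ m),
      φ (m + cyclotomicExponent p)
          (PadicInt.toZModPow (m + cyclotomicExponent p) ((ξ : ℤ_[p]ˣ) : ℤ_[p]) *
            (cyclotomicGenerator p : ZMod (p ^ (m + cyclotomicExponent p))) ^ s.val) *
        ((s.val.choose k : ℕ) : ℚ_[p]), fun _ _ ↦ rfl, fun k m ↦ ?_⟩
  haveI := neZero_torsionOrder p
  haveI := Fintype.ofFinite (rootsOfUnity (torsionOrder p) ℤ_[p])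
  rw [hRS]
  simp only [finsum_eq_sum_of_fintype, Finset.mul_sum, hψ, mul_assoc]

end Scaling

section SymbolTable

variable (W : WeierstrassCurve ℚ) [W.IsElliptic] (p : ℕ) [Fact p.Prime]

omit [W.IsElliptic] in
/-- **Non-split branch.** `f₀` a newform of `W`, `p` non-split multiplicative, `x = u·ϖ₀·[·]⁺_{f₀}`
with `‖u‖_p = 1` (`hx`: the identification), `RS` the signed Riemann sums of `x`, `‖x(a/p^m)‖ ≤ C`,
`k < p^{n₀}`, `C·p⁻¹ < ‖RS k n₀‖` and `‖RS k n₀‖ = 1` ⟹ `‖[T^k](ϖ₀·L)‖ = 1` for THE non-split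
function (every `L` with `IsMultPAdicLFunctionOf f₀ p (-1) L`). [cite: MazurTateTeitelbaum1986Invent, §I.10 Prop., §I.12–I.13]
[cite: SteinWuthrich2013, §3 and §4.2] -/
theorem norm_coeff_C_mul_eq_one_of_symbolTable_modP_nonsplit {N₀ : ℕ} [NeZero N₀]
    {f₀ : CuspForm (Gamma0 N₀) 2} (hf₀ : IsNewformOf W f₀)
    (hmult : W.HasMultiplicativeReductionAtPrime p)
    (hns : ¬ W.HasSplitMultiplicativeReductionAtPrime p) {ϖ₀ u : ℚ} (hu : ‖((u : ℚ) : ℚ_[p])‖ = 1)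
    {x : ℚ → ℚ} (hx : ∀ r : ℚ, x r = u * ϖ₀ * ratPlusSymbol f₀ r) {RS : ℕ → ℕ → ℚ_[p]}
    (hRS : ∀ k m : ℕ, RS k m =
      ∑ᶠ ξ : rootsOfUnity (torsionOrder p) ℤ_[p], ∑ s : ZMod (p ^ m),
        (fun (m : ℕ) (a : ZMod (p ^ m)) ↦
            (-1 : ℚ_[p]) ^ m * (x ((a.val : ℚ) / (p : ℚ) ^ m) : ℚ_[p]))
          (m + cyclotomicExponent p)
            (PadicInt.toZModPow (m + cyclotomicExponent p) ((ξ : ℤ_[p]ˣ) : ℤ_[p]) *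
              (cyclotomicGenerator p : ZMod (p ^ (m + cyclotomicExponent p))) ^ s.val) *
          ((s.val.choose k : ℕ) : ℚ_[p]))
    {C : ℝ} (hC : ∀ (m : ℕ) (a : ZMod (p ^ m)), ‖(x ((a.val : ℚ) / (p : ℚ) ^ m) : ℚ_[p])‖ ≤ C)
    {k n₀ : ℕ} (hk : k < p ^ n₀) (hlt : C * (p : ℝ)⁻¹ < ‖RS k n₀‖) (hunit : ‖RS k n₀‖ = 1)
    {L : PowerSeries ℚ_[p]} (hL : IsMultPAdicLFunctionOf f₀ p (-1) L) :
    ‖PowerSeries.coeff k (PowerSeries.C ((ϖ₀ : ℚ) : ℚ_[p]) * L)‖ = 1 := by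
  obtain ⟨c, hc⟩ : ∃ c : ℚ_[p], c = ((u : ℚ) : ℚ_[p]) * ((ϖ₀ : ℚ) : ℚ_[p]) := ⟨_, rfl⟩
  have hϖc : ‖((ϖ₀ : ℚ) : ℚ_[p])‖ = ‖c‖ := by rw [hc, norm_mul, hu, one_mul]
  have hx' : ∀ (m : ℕ) (a : ZMod (p ^ m)),
      (x ((a.val : ℚ) / (p : ℚ) ^ m) : ℚ_[p]) =
        c * (ratPlusSymbol f₀ ((a.val : ℚ) / (p : ℚ) ^ m) : ℚ_[p]) := by
    intro m a
    rw [hx, Rat.cast_mul, Rat.cast_mul, hc]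
  have hxs : ∀ (m : ℕ) (a : ZMod (p ^ m)),
      (-1 : ℚ_[p]) ^ m * (x ((a.val : ℚ) / (p : ℚ) ^ m) : ℚ_[p]) =
        c * ((-1 : ℚ_[p]) ^ m * (ratPlusSymbol f₀ ((a.val : ℚ) / (p : ℚ) ^ m) : ℚ_[p])) := by
    intro m a
    rw [hx' m a]
    ring
  obtain ⟨RS', hRS', hscale⟩ := exists_riemannSum_eq_const_mul
    (φ := fun (m : ℕ) (a : ZMod (p ^ m)) ↦
      (-1 : ℚ_[p]) ^ m * (ratPlusSymbol f₀ ((a.val : ℚ) / (p : ℚ) ^ m) : ℚ_[p]))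
    (ψ := fun (m : ℕ) (a : ZMod (p ^ m)) ↦
      (-1 : ℚ_[p]) ^ m * (x ((a.val : ℚ) / (p : ℚ) ^ m) : ℚ_[p])) hxs hRS
  have hc0 : c ≠ 0 := by
    rintro rfl
    rw [hscale, zero_mul, norm_zero] at hunit
    exact zero_ne_one hunit
  have hc' : 0 < ‖c‖ := norm_pos_iff.mpr hc0
  have hCf : ∀ (m : ℕ) (a : ZMod (p ^ m)),
      ‖(ratPlusSymbol f₀ ((a.val : ℚ) / (p : ℚ) ^ m) : ℚ_[p])‖ ≤ C / ‖c‖ := by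
    intro m a
    rw [le_div_iff₀ hc']
    calc ‖(ratPlusSymbol f₀ ((a.val : ℚ) / (p : ℚ) ^ m) : ℚ_[p])‖ * ‖c‖
        = ‖(x ((a.val : ℚ) / (p : ℚ) ^ m) : ℚ_[p])‖ := by rw [hx', norm_mul, mul_comm]
      _ ≤ C := hC m a
  have hlt' : C / ‖c‖ * (p : ℝ)⁻¹ < ‖RS' k n₀‖ := by
    have hre : C / ‖c‖ * (p : ℝ)⁻¹ = C * (p : ℝ)⁻¹ / ‖c‖ := by ring
    rw [hre, div_lt_iff₀ hc', mul_comm (‖RS' k n₀‖)]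
    have h := hlt
    rwa [hscale, norm_mul] at h
  have hnorm := (hL.norm_coeff_eq_of_nonsplit_of_mul_inv_lt hRS' hf₀ hmult hns hCf hk hlt').1
  rw [PowerSeries.coeff_C_mul, norm_mul, hnorm, hϖc, ← norm_mul, ← hscale, hunit]

omit [W.IsElliptic] in
/-- **Split branch** (THE split function, every `L` with `IsSplitMultPAdicLFunctionOf f₀ p L`; no
sign). [cite: MazurTateTeitelbaum1986Invent, §I.10 Prop., §I.12–I.13, §I.15] [cite: SteinWuthrich2013, §3 and §4.2] -/
theorem norm_coeff_C_mul_eq_one_of_symbolTable_modP_split {N₀ : ℕ} [NeZero N₀]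
    {f₀ : CuspForm (Gamma0 N₀) 2} (hf₀ : IsNewformOf W f₀)
    (hsplit : W.HasSplitMultiplicativeReductionAtPrime p) {ϖ₀ u : ℚ} (hu : ‖((u : ℚ) : ℚ_[p])‖ = 1)
    {x : ℚ → ℚ} (hx : ∀ r : ℚ, x r = u * ϖ₀ * ratPlusSymbol f₀ r) {RS : ℕ → ℕ → ℚ_[p]}
    (hRS : ∀ k m : ℕ, RS k m =
      ∑ᶠ ξ : rootsOfUnity (torsionOrder p) ℤ_[p], ∑ s : ZMod (p ^ m),
        (fun (m : ℕ) (a : ZMod (p ^ m)) ↦ (x ((a.val : ℚ) / (p : ℚ) ^ m) : ℚ_[p]))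
          (m + cyclotomicExponent p)
            (PadicInt.toZModPow (m + cyclotomicExponent p) ((ξ : ℤ_[p]ˣ) : ℤ_[p]) *
              (cyclotomicGenerator p : ZMod (p ^ (m + cyclotomicExponent p))) ^ s.val) *
          ((s.val.choose k : ℕ) : ℚ_[p]))
    {C : ℝ} (hC : ∀ (m : ℕ) (a : ZMod (p ^ m)), ‖(x ((a.val : ℚ) / (p : ℚ) ^ m) : ℚ_[p])‖ ≤ C)
    {k n₀ : ℕ} (hk : k < p ^ n₀) (hlt : C * (p : ℝ)⁻¹ < ‖RS k n₀‖) (hunit : ‖RS k n₀‖ = 1)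
    {L : PowerSeries ℚ_[p]} (hL : IsSplitMultPAdicLFunctionOf f₀ p L) :
    ‖PowerSeries.coeff k (PowerSeries.C ((ϖ₀ : ℚ) : ℚ_[p]) * L)‖ = 1 := by
  obtain ⟨c, hc⟩ : ∃ c : ℚ_[p], c = ((u : ℚ) : ℚ_[p]) * ((ϖ₀ : ℚ) : ℚ_[p]) := ⟨_, rfl⟩
  have hϖc : ‖((ϖ₀ : ℚ) : ℚ_[p])‖ = ‖c‖ := by rw [hc, norm_mul, hu, one_mul]
  have hx' : ∀ (m : ℕ) (a : ZMod (p ^ m)),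
      (x ((a.val : ℚ) / (p : ℚ) ^ m) : ℚ_[p]) =
        c * (ratPlusSymbol f₀ ((a.val : ℚ) / (p : ℚ) ^ m) : ℚ_[p]) := by
    intro m a
    rw [hx, Rat.cast_mul, Rat.cast_mul, hc]
  obtain ⟨RS', hRS', hscale⟩ := exists_riemannSum_eq_const_mul
    (φ := fun (m : ℕ) (a : ZMod (p ^ m)) ↦ (ratPlusSymbol f₀ ((a.val : ℚ) / (p : ℚ) ^ m) : ℚ_[p]))
    (ψ := fun (m : ℕ) (a : ZMod (p ^ m)) ↦ (x ((a.val : ℚ) / (p : ℚ) ^ m) : ℚ_[p])) hx' hRS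
  have hc0 : c ≠ 0 := by
    rintro rfl
    rw [hscale, zero_mul, norm_zero] at hunit
    exact zero_ne_one hunit
  have hc' : 0 < ‖c‖ := norm_pos_iff.mpr hc0
  have hCf : ∀ (m : ℕ) (a : ZMod (p ^ m)),
      ‖(ratPlusSymbol f₀ ((a.val : ℚ) / (p : ℚ) ^ m) : ℚ_[p])‖ ≤ C / ‖c‖ := by
    intro m a
    rw [le_div_iff₀ hc']
    calc ‖(ratPlusSymbol f₀ ((a.val : ℚ) / (p : ℚ) ^ m) : ℚ_[p])‖ * ‖c‖
        = ‖(x ((a.val : ℚ) / (p : ℚ) ^ m) : ℚ_[p])‖ := by rw [hx', norm_mul, mul_comm]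
      _ ≤ C := hC m a
  have hlt' : C / ‖c‖ * (p : ℝ)⁻¹ < ‖RS' k n₀‖ := by
    have hre : C / ‖c‖ * (p : ℝ)⁻¹ = C * (p : ℝ)⁻¹ / ‖c‖ := by ring
    rw [hre, div_lt_iff₀ hc', mul_comm (‖RS' k n₀‖)]
    have h := hlt
    rwa [hscale, norm_mul] at h
  have hnorm := (hL.norm_coeff_eq_of_split_of_mul_inv_lt hRS' hsplit hf₀ hCf hk hlt').1
  rw [PowerSeries.coeff_C_mul, norm_mul, hnorm, hϖc, ← norm_mul, ← hscale, hunit]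

/-- **`Iwasawa.UnitCoeffAt W p n` from a symbol table certified MODULO `p`** at a multiplicative
prime: ONE newform `f₀` of `W`, its period ratio `ϖ₀`, a unit `u` and a table `x = u·ϖ₀·[·]⁺_{f₀}`
(`hx`), and — for the reduction sign's kind — a bound `‖x(a/p^m)‖ ≤ C`, a level `n₀` with
`p^{n₀} > k`, the exact Riemann sums of `x` with `C·p⁻¹ < ‖RS k n₀‖` and `‖RS k n₀‖ = 1` at
`k = n` (non-split, signed sums) resp. `k = n + 1` (split). For every newform / every `ϖ` by
p277881 (`unitCoeffAt_of_newform`). Nothing about any curve is asserted; nothing booked.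
[cite: MazurTateTeitelbaum1986Invent, §I.10 Prop., §I.12–I.14] [cite: SteinWuthrich2013, §3 and §4.2]
[cite: AtkinLehner1970, Thm. 4] -/
theorem unitCoeffAt_of_symbolTable_modP (hmult : W.HasMultiplicativeReductionAtPrime p)
    {N₀ : ℕ} [NeZero N₀] {f₀ : CuspForm (Gamma0 N₀) 2}
    (hf₀ : IsNewformOf W f₀) {ϖ₀ : ℚ} (hϖ₀ : (ϖ₀ : ℝ) * W.realPeriodRat = plusPeriod f₀)
    {u : ℚ} (hu : ‖((u : ℚ) : ℚ_[p])‖ = 1) {x : ℚ → ℚ}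
    (hx : ∀ r : ℚ, x r = u * ϖ₀ * ratPlusSymbol f₀ r) {n : ℕ}
    (hns : ¬ W.HasSplitMultiplicativeReductionAtPrime p →
        ∃ (C : ℝ) (n₀ : ℕ) (RS : ℕ → ℕ → ℚ_[p]),
          (∀ k m : ℕ, RS k m =
            ∑ᶠ ξ : rootsOfUnity (torsionOrder p) ℤ_[p], ∑ s : ZMod (p ^ m),
              (fun (m : ℕ) (a : ZMod (p ^ m)) ↦
                  (-1 : ℚ_[p]) ^ m * (x ((a.val : ℚ) / (p : ℚ) ^ m) : ℚ_[p]))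
                (m + cyclotomicExponent p)
                  (PadicInt.toZModPow (m + cyclotomicExponent p) ((ξ : ℤ_[p]ˣ) : ℤ_[p]) *
                    (cyclotomicGenerator p : ZMod (p ^ (m + cyclotomicExponent p))) ^ s.val) *
                ((s.val.choose k : ℕ) : ℚ_[p])) ∧
          (∀ (m : ℕ) (a : ZMod (p ^ m)), ‖(x ((a.val : ℚ) / (p : ℚ) ^ m) : ℚ_[p])‖ ≤ C) ∧
          n < p ^ n₀ ∧ C * (p : ℝ)⁻¹ < ‖RS n n₀‖ ∧ ‖RS n n₀‖ = 1)
    (hs : W.HasSplitMultiplicativeReductionAtPrime p →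
        ∃ (C : ℝ) (n₀ : ℕ) (RS : ℕ → ℕ → ℚ_[p]),
          (∀ k m : ℕ, RS k m =
            ∑ᶠ ξ : rootsOfUnity (torsionOrder p) ℤ_[p], ∑ s : ZMod (p ^ m),
              (fun (m : ℕ) (a : ZMod (p ^ m)) ↦ (x ((a.val : ℚ) / (p : ℚ) ^ m) : ℚ_[p]))
                (m + cyclotomicExponent p)
                  (PadicInt.toZModPow (m + cyclotomicExponent p) ((ξ : ℤ_[p]ˣ) : ℤ_[p]) *
                    (cyclotomicGenerator p : ZMod (p ^ (m + cyclotomicExponent p))) ^ s.val) *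
                ((s.val.choose k : ℕ) : ℚ_[p])) ∧
          (∀ (m : ℕ) (a : ZMod (p ^ m)), ‖(x ((a.val : ℚ) / (p : ℚ) ^ m) : ℚ_[p])‖ ≤ C) ∧
          n + 1 < p ^ n₀ ∧ C * (p : ℝ)⁻¹ < ‖RS (n + 1) n₀‖ ∧ ‖RS (n + 1) n₀‖ = 1) :
    Iwasawa.UnitCoeffAt W p n := by
  refine @unitCoeffAt_of_newform W _ p _ N₀ _ f₀ hf₀ ϖ₀ hϖ₀ n ?_ ?_
  · intro h L hL
    obtain ⟨C, n₀, RS, hRS, hC, hk, hlt, hunit⟩ := hns h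
    exact norm_coeff_C_mul_eq_one_of_symbolTable_modP_nonsplit W p hf₀ hmult h hu hx hRS hC hk hlt
      hunit hL
  · intro h L hL
    obtain ⟨C, n₀, RS, hRS, hC, hk, hlt, hunit⟩ := hs h
    exact norm_coeff_C_mul_eq_one_of_symbolTable_modP_split W p hf₀ h hu hx hRS hC hk hlt hunit hL

/-- Hence x11a's `MuAnZeroAt W p` (the T-WK road's input) from a mod-`p` symbol-table certificate at
ANY index (the `MuAnZero-only` rows with a large `λ`). [cite: GreenbergVatsal2000, p. 2–3, (1)–(2)] -/
theorem muAnZeroAt_of_symbolTable_modP [W.IsGloballyMinimal]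
    (hmult : W.HasMultiplicativeReductionAtPrime p)
    {N₀ : ℕ} [NeZero N₀] {f₀ : CuspForm (Gamma0 N₀) 2}
    (hf₀ : IsNewformOf W f₀) {ϖ₀ : ℚ} (hϖ₀ : (ϖ₀ : ℝ) * W.realPeriodRat = plusPeriod f₀)
    {u : ℚ} (hu : ‖((u : ℚ) : ℚ_[p])‖ = 1) {x : ℚ → ℚ}
    (hx : ∀ r : ℚ, x r = u * ϖ₀ * ratPlusSymbol f₀ r) {n : ℕ}
    (hns : ¬ W.HasSplitMultiplicativeReductionAtPrime p →
        ∃ (C : ℝ) (n₀ : ℕ) (RS : ℕ → ℕ → ℚ_[p]),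
          (∀ k m : ℕ, RS k m =
            ∑ᶠ ξ : rootsOfUnity (torsionOrder p) ℤ_[p], ∑ s : ZMod (p ^ m),
              (fun (m : ℕ) (a : ZMod (p ^ m)) ↦
                  (-1 : ℚ_[p]) ^ m * (x ((a.val : ℚ) / (p : ℚ) ^ m) : ℚ_[p]))
                (m + cyclotomicExponent p)
                  (PadicInt.toZModPow (m + cyclotomicExponent p) ((ξ : ℤ_[p]ˣ) : ℤ_[p]) *
                    (cyclotomicGenerator p : ZMod (p ^ (m + cyclotomicExponent p))) ^ s.val) *
                ((s.val.choose k : ℕ) : ℚ_[p])) ∧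
          (∀ (m : ℕ) (a : ZMod (p ^ m)), ‖(x ((a.val : ℚ) / (p : ℚ) ^ m) : ℚ_[p])‖ ≤ C) ∧
          n < p ^ n₀ ∧ C * (p : ℝ)⁻¹ < ‖RS n n₀‖ ∧ ‖RS n n₀‖ = 1)
    (hs : W.HasSplitMultiplicativeReductionAtPrime p →
        ∃ (C : ℝ) (n₀ : ℕ) (RS : ℕ → ℕ → ℚ_[p]),
          (∀ k m : ℕ, RS k m =
            ∑ᶠ ξ : rootsOfUnity (torsionOrder p) ℤ_[p], ∑ s : ZMod (p ^ m),
              (fun (m : ℕ) (a : ZMod (p ^ m)) ↦ (x ((a.val : ℚ) / (p : ℚ) ^ m) : ℚ_[p]))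
                (m + cyclotomicExponent p)
                  (PadicInt.toZModPow (m + cyclotomicExponent p) ((ξ : ℤ_[p]ˣ) : ℤ_[p]) *
                    (cyclotomicGenerator p : ZMod (p ^ (m + cyclotomicExponent p))) ^ s.val) *
                ((s.val.choose k : ℕ) : ℚ_[p])) ∧
          (∀ (m : ℕ) (a : ZMod (p ^ m)), ‖(x ((a.val : ℚ) / (p : ℚ) ^ m) : ℚ_[p])‖ ≤ C) ∧
          n + 1 < p ^ n₀ ∧ C * (p : ℝ)⁻¹ < ‖RS (n + 1) n₀‖ ∧ ‖RS (n + 1) n₀‖ = 1) :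
    MuAnZeroAt W p :=
  Iwasawa.muAnZeroAt_of_unitCoeffAt (unitCoeffAt_of_symbolTable_modP W p hmult hf₀ hϖ₀ hu hx hns hs)

end SymbolTable

section ClassLevel

variable (W : WeierstrassCurve ℚ) [W.IsElliptic] [W.IsGloballyMinimal] (p : ℕ) [Fact p.Prime]

/-- **¬(ram) MINIMAL PAIR from a symbol table certified modulo `p`** (= p276240's
`bsdp_of_unitCoeffAt_one` ∘ `unitCoeffAt_of_symbolTable_modP` at index `1`): X11b, `p ≥ 5`,
`ρ̄_{E,p}` onto; certificate `‖RS 1 n₀‖ = 1` non-split (`p^{n₀} > 1`) / `‖RS 2 n₀‖ = 1` split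
(`p^{n₀} > 2`), `C·p⁻¹ < 1`; named facts Kato–Wuthrich A32, Stein–Wuthrich Thm 6.1 ×2 + §4.2 ×2,
Disegni 2020 Thm 1, GZK, modularity (+ at split `p`: a second multiplicative prime or
`RelativeExceptionalLeadingTermAt W p`), modulo `hx`. CONDITIONAL; nothing booked; X11b stays
CONSTRUCTION-SHAPED. [cite: Wuthrich2014, Thm. 3 (p. 382) and Cor. 19 proof (p. 399)]
[cite: SteinWuthrich2013, Thm. 6.1 (p. 20), §4.2, §3] [cite: Disegni2020, Thm. 1 (§1.2), hypothesis (∗)]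
[cite: MazurTateTeitelbaum1986Invent, §I.10 Prop. and §I.12–I.14] -/
theorem bsdp_of_symbolTable_modP_one
    (hKato : kato_charIdeal_dvd_multiplicative_of_surjective)
    (hJn : thm61_nonsplitMultiplicative) (hJs : thm61_splitMultiplicative)
    (hHn : exists_isMultCanonical) (hHs : exists_isSplitMultCanonical)
    (hD : thm1_padicBSD_rankOne_multiplicative)
    (hGZK : rank_eq_analyticRank_of_analyticRank_le_one) (hpar : nonempty_modularParametrizationData)
    (hX : ClassX11b W p) (hp : 5 ≤ p) (hsurj : Surj W p)
    {N₀ : ℕ} [NeZero N₀] {f₀ : CuspForm (Gamma0 N₀) 2}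
    (hf₀ : IsNewformOf W f₀) {ϖ₀ : ℚ} (hϖ₀ : (ϖ₀ : ℝ) * W.realPeriodRat = plusPeriod f₀)
    {u : ℚ} (hu : ‖((u : ℚ) : ℚ_[p])‖ = 1) {x : ℚ → ℚ}
    (hx : ∀ r : ℚ, x r = u * ϖ₀ * ratPlusSymbol f₀ r)
    (hns : ¬ W.HasSplitMultiplicativeReductionAtPrime p →
        ∃ (C : ℝ) (n₀ : ℕ) (RS : ℕ → ℕ → ℚ_[p]),
          (∀ k m : ℕ, RS k m =
            ∑ᶠ ξ : rootsOfUnity (torsionOrder p) ℤ_[p], ∑ s : ZMod (p ^ m),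
              (fun (m : ℕ) (a : ZMod (p ^ m)) ↦
                  (-1 : ℚ_[p]) ^ m * (x ((a.val : ℚ) / (p : ℚ) ^ m) : ℚ_[p]))
                (m + cyclotomicExponent p)
                  (PadicInt.toZModPow (m + cyclotomicExponent p) ((ξ : ℤ_[p]ˣ) : ℤ_[p]) *
                    (cyclotomicGenerator p : ZMod (p ^ (m + cyclotomicExponent p))) ^ s.val) *
                ((s.val.choose k : ℕ) : ℚ_[p])) ∧
          (∀ (m : ℕ) (a : ZMod (p ^ m)), ‖(x ((a.val : ℚ) / (p : ℚ) ^ m) : ℚ_[p])‖ ≤ C) ∧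
          1 < p ^ n₀ ∧ C * (p : ℝ)⁻¹ < ‖RS 1 n₀‖ ∧ ‖RS 1 n₀‖ = 1)
    (hs : W.HasSplitMultiplicativeReductionAtPrime p →
        ∃ (C : ℝ) (n₀ : ℕ) (RS : ℕ → ℕ → ℚ_[p]),
          (∀ k m : ℕ, RS k m =
            ∑ᶠ ξ : rootsOfUnity (torsionOrder p) ℤ_[p], ∑ s : ZMod (p ^ m),
              (fun (m : ℕ) (a : ZMod (p ^ m)) ↦ (x ((a.val : ℚ) / (p : ℚ) ^ m) : ℚ_[p]))
                (m + cyclotomicExponent p)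
                  (PadicInt.toZModPow (m + cyclotomicExponent p) ((ξ : ℤ_[p]ˣ) : ℤ_[p]) *
                    (cyclotomicGenerator p : ZMod (p ^ (m + cyclotomicExponent p))) ^ s.val) *
                ((s.val.choose k : ℕ) : ℚ_[p])) ∧
          (∀ (m : ℕ) (a : ZMod (p ^ m)), ‖(x ((a.val : ℚ) / (p : ℚ) ^ m) : ℚ_[p])‖ ≤ C) ∧
          1 + 1 < p ^ n₀ ∧ C * (p : ℝ)⁻¹ < ‖RS (1 + 1) n₀‖ ∧ ‖RS (1 + 1) n₀‖ = 1)
    (hγ : W.HasSplitMultiplicativeReductionAtPrime p →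
      (∃ (m : ℕ) (_ : Fact m.Prime), m ≠ p ∧ W.HasMultiplicativeReductionAtPrime m) ∨
        RelativeExceptionalLeadingTermAt W p) :
    BSDp W p :=
  bsdp_of_unitCoeffAt_one W p hKato hJn hJs hHn hHs hD hGZK hpar hX hp hsurj
    (unitCoeffAt_of_symbolTable_modP W p hX.2.2.1 hf₀ hϖ₀ hu hx hns hs) hγ

/-- **(ram) MINIMAL PAIR from a symbol table certified modulo `p`** (= p282302's
`bsdp_of_ram_of_unitCoeffAt_one` ∘ `unitCoeffAt_of_symbolTable_modP` at index `1`): the (ram) atom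
of X11b — non-split at ANY odd `p`, split at `p ≥ 5`; named facts Skinner 2016 Thm A,
Stein–Wuthrich Thm 6.1 ×2 + §4.2 ×2, Disegni 2020 Thm 1, GZK, modularity; modulo `hx`. No
regulator row, no `μ`. CONDITIONAL; nothing booked; readings at `p = 3` are the x11b3 team's.
[cite: Skinner2016PacificMC, Thm. A] [cite: SteinWuthrich2013, Thm. 6.1 (p. 20), §4.2, §3]
[cite: Disegni2020, Thm. 1 (§1.2), hypothesis (∗)] [cite: MazurTateTeitelbaum1986Invent, §I.10 Prop. and §I.12–I.14] -/
theorem bsdp_of_ram_of_symbolTable_modP_one (hA : thmA_charIdeal_multiplicative)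
    (hJn : thm61_nonsplitMultiplicative) (hJs : thm61_splitMultiplicative)
    (hHn : exists_isMultCanonical) (hHs : exists_isSplitMultCanonical)
    (hD : thm1_padicBSD_rankOne_multiplicative)
    (hGZK : rank_eq_analyticRank_of_analyticRank_le_one) (hpar : nonempty_modularParametrizationData)
    (hX : ClassX11b W p) (hram : Ram W p)
    (hp5 : W.HasSplitMultiplicativeReductionAtPrime p → 5 ≤ p)
    {N₀ : ℕ} [NeZero N₀] {f₀ : CuspForm (Gamma0 N₀) 2}
    (hf₀ : IsNewformOf W f₀) {ϖ₀ : ℚ} (hϖ₀ : (ϖ₀ : ℝ) * W.realPeriodRat = plusPeriod f₀)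
    {u : ℚ} (hu : ‖((u : ℚ) : ℚ_[p])‖ = 1) {x : ℚ → ℚ}
    (hx : ∀ r : ℚ, x r = u * ϖ₀ * ratPlusSymbol f₀ r)
    (hns : ¬ W.HasSplitMultiplicativeReductionAtPrime p →
        ∃ (C : ℝ) (n₀ : ℕ) (RS : ℕ → ℕ → ℚ_[p]),
          (∀ k m : ℕ, RS k m =
            ∑ᶠ ξ : rootsOfUnity (torsionOrder p) ℤ_[p], ∑ s : ZMod (p ^ m),
              (fun (m : ℕ) (a : ZMod (p ^ m)) ↦
                  (-1 : ℚ_[p]) ^ m * (x ((a.val : ℚ) / (p : ℚ) ^ m) : ℚ_[p]))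
                (m + cyclotomicExponent p)
                  (PadicInt.toZModPow (m + cyclotomicExponent p) ((ξ : ℤ_[p]ˣ) : ℤ_[p]) *
                    (cyclotomicGenerator p : ZMod (p ^ (m + cyclotomicExponent p))) ^ s.val) *
                ((s.val.choose k : ℕ) : ℚ_[p])) ∧
          (∀ (m : ℕ) (a : ZMod (p ^ m)), ‖(x ((a.val : ℚ) / (p : ℚ) ^ m) : ℚ_[p])‖ ≤ C) ∧
          1 < p ^ n₀ ∧ C * (p : ℝ)⁻¹ < ‖RS 1 n₀‖ ∧ ‖RS 1 n₀‖ = 1)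
    (hs : W.HasSplitMultiplicativeReductionAtPrime p →
        ∃ (C : ℝ) (n₀ : ℕ) (RS : ℕ → ℕ → ℚ_[p]),
          (∀ k m : ℕ, RS k m =
            ∑ᶠ ξ : rootsOfUnity (torsionOrder p) ℤ_[p], ∑ s : ZMod (p ^ m),
              (fun (m : ℕ) (a : ZMod (p ^ m)) ↦ (x ((a.val : ℚ) / (p : ℚ) ^ m) : ℚ_[p]))
                (m + cyclotomicExponent p)
                  (PadicInt.toZModPow (m + cyclotomicExponent p) ((ξ : ℤ_[p]ˣ) : ℤ_[p]) *
                    (cyclotomicGenerator p : ZMod (p ^ (m + cyclotomicExponent p))) ^ s.val) *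
                ((s.val.choose k : ℕ) : ℚ_[p])) ∧
          (∀ (m : ℕ) (a : ZMod (p ^ m)), ‖(x ((a.val : ℚ) / (p : ℚ) ^ m) : ℚ_[p])‖ ≤ C) ∧
          1 + 1 < p ^ n₀ ∧ C * (p : ℝ)⁻¹ < ‖RS (1 + 1) n₀‖ ∧ ‖RS (1 + 1) n₀‖ = 1) :
    BSDp W p :=
  bsdp_of_ram_of_unitCoeffAt_one W p hA hJn hJs hHn hHs hD hGZK hpar hX hram hp5
    (unitCoeffAt_of_symbolTable_modP W p hX.2.2.1 hf₀ hϖ₀ hu hx hns hs)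

end ClassLevel

end Summit.BirchSwinnertonDyer.Rank1Residual.X11b.ClassClosure

end
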